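import Summits.AnomalousDissipation.AnomalousDissipation.Theorems.SolenoidalFractalHomogenisationLagrangianStepWindowLedger
import HarnessLib

/-!
# K1L_D `LagrangianRenormalisationStepDesign` (stmt-AnomalousDissipation-27980), line «onelevel-design», stub `stub_oneLevelL_IW`:
# the WINDOW LEDGER with ABSOLUTE leftovers (helper; `--supports … --as helper`; sequel of `…LagrangianStepWindowLedger`, p644546)

Pure Hilbert-space algebra, no PDE (lead-k1l-onelevel-p1 g2, finding F-lead-2, 2026-08-28).  In the application of the window ledger to the
refresh windows of level `m+1`, a small part of each window's error is NOT dissipation-dominated (the far spectral tail of the leak, the residual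
fast content of the exact window map): `u (k+1) = T k (u k) + e k + g k` with `e k` dissipation-dominated,
`|⟪y, e k⟫| ≤ η √(‖u k‖² − ‖T k (u k)‖²) √(‖y‖² − ‖(T k)† y‖²)`, and `‖g k‖ ≤ γ k` merely small in norm.  Then, with `G = Σ_{k<K} γ k`,
`‖u K‖² ≤ ‖v K‖² + 3η·(‖v 0‖² − ‖v K‖²) + 6·(‖v 0‖ + G)·G` (`window_ledger_abs`): the decay-relative term of `window_ledger` is unchanged and the
leftovers enter absolutely — in the application they are super-small and are paid by the a-priori base drop `(1 − e^{−4π² kbar_m lo′})‖w₀‖²`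
through the choice of `m⋆(R, E)`.  Same proof as `window_ledger` (duality sum peeled window by window, one Cauchy–Schwarz, energy and
discrepancy sums), each step carrying the leftover linearly.
Infrastructure for rung F-D1.A0; NOT a proof of the crux, of Onsager's conjecture or of anomalous dissipation.
-/

set_option linter.dupNamespace false

namespace Summit.AnomalousDissipation.AnomalousDissipation.Theorems.SolenoidalFractalHomogenisation.LagrangianStep

open scoped InnerProductSpace
open ContinuousLinearMap

noncomputable section

variable {V : Type*} [NormedAddCommGroup V] [InnerProductSpace ℝ V] [CompleteSpace V]

/-! ## The window ledger with ABSOLUTE leftovers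

In the application a small part of each window's error is not dissipation-dominated (far spectral tail of the leak, the residual fast content of the
exact map): `u (k+1) = T k (u k) + e k + g k` with `e k` dissipation-dominated as before and `‖g k‖ ≤ γ k` merely small in norm.  The ledger then
carries an extra ABSOLUTE term `6 (‖v 0‖ + Σγ) Σγ`, to be paid by the a-priori (baseT) drop through the choice of `m⋆(R, E)`. -/

/-- `√((a+b)² + c) ≤ √(a² + c) + b` for nonnegative reals. -/
theorem sqrt_add_sq_add_le {a b c : ℝ} (ha : 0 ≤ a) (hb : 0 ≤ b) (hc : 0 ≤ c) :
    Real.sqrt ((a + b) ^ 2 + c) ≤ Real.sqrt (a ^ 2 + c) + b := by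
  have hR : 0 ≤ Real.sqrt (a ^ 2 + c) + b := by positivity
  rw [← Real.sqrt_sq hR]
  apply Real.sqrt_le_sqrt
  have h1 : a ≤ Real.sqrt (a ^ 2 + c) := by
    calc a = Real.sqrt (a ^ 2) := (Real.sqrt_sq ha).symm
      _ ≤ Real.sqrt (a ^ 2 + c) := Real.sqrt_le_sqrt (by linarith)
  have h2 : (Real.sqrt (a ^ 2 + c)) ^ 2 = a ^ 2 + c := Real.sq_sqrt (by positivity)
  nlinarith

/-- With an absolute leftover the perturbed step still does not grow beyond the leftover: `‖T u + e + g‖ ≤ ‖u‖ + ‖g‖` (`η ≤ 1/8`). -/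
theorem norm_step_le {T : V →L[ℝ] V} (hT : ∀ x, ‖T x‖ ≤ ‖x‖) {u e : V} (g : V) {η : ℝ} (hη : 0 ≤ η) (hη8 : η ≤ 1 / 8)
    (hDD : ∀ y : V, |⟪y, e⟫_ℝ| ≤ η * Real.sqrt (‖u‖ ^ 2 - ‖T u‖ ^ 2) * Real.sqrt (‖y‖ ^ 2 - ‖adjoint T y‖ ^ 2)) :
    ‖T u + e + g‖ ≤ ‖u‖ + ‖g‖ := by
  have h1 := dissip_le_energy_drop hT hη hDD
  have hD : 0 ≤ ‖u‖ ^ 2 - ‖T u‖ ^ 2 := dissip_nonneg hT u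
  have hκ : 0 ≤ 1 - 2 * η - η ^ 2 := by nlinarith
  have h2 : ‖T u + e‖ ^ 2 ≤ ‖u‖ ^ 2 := by nlinarith [mul_nonneg hκ hD]
  have h3 : ‖T u + e‖ ≤ ‖u‖ := by
    nlinarith [norm_nonneg (T u + e), norm_nonneg u]
  calc ‖T u + e + g‖ ≤ ‖T u + e‖ + ‖g‖ := norm_add_le _ _
    _ ≤ ‖u‖ + ‖g‖ := by linarith

/-- Norm bound of the perturbed sequence with leftovers: `‖u K‖ ≤ ‖u 0‖ + Σ_{k<K} γ k`. -/
theorem norm_perturbed_le (T : ℕ → V →L[ℝ] V) (hT : ∀ k x, ‖T k x‖ ≤ ‖x‖) (u e g : ℕ → V) (γ : ℕ → ℝ) (η : ℝ)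
    (hη : 0 ≤ η) (hη8 : η ≤ 1 / 8) (hu : ∀ k, u (k + 1) = T k (u k) + e k + g k) (hg : ∀ k, ‖g k‖ ≤ γ k)
    (hDD : ∀ k, ∀ y : V, |⟪y, e k⟫_ℝ| ≤
      η * Real.sqrt (‖u k‖ ^ 2 - ‖T k (u k)‖ ^ 2) * Real.sqrt (‖y‖ ^ 2 - ‖adjoint (T k) y‖ ^ 2))
    (K : ℕ) : ‖u K‖ ≤ ‖u 0‖ + ∑ k ∈ Finset.range K, γ k := by
  induction K with
  | zero => simp
  | succ K ih =>
    rw [Finset.sum_range_succ, hu K]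
    have := norm_step_le (hT K) (g K) hη hη8 (hDD K)
    linarith [hg K]

/-- ENERGY SUM with leftovers: `(1 − 2η − η²)·Σ_{k<K} 𝔇 k (u k) + ‖u K‖² ≤ ‖u 0‖² + 2 G_K (‖u 0‖ + G_K)`, `G_K = Σ_{k<K} γ k`. -/
theorem dissip_sum_le_abs (T : ℕ → V →L[ℝ] V) (hT : ∀ k x, ‖T k x‖ ≤ ‖x‖) (u e g : ℕ → V) (γ : ℕ → ℝ) (η : ℝ)
    (hη : 0 ≤ η) (hη8 : η ≤ 1 / 8) (hγ : ∀ k, 0 ≤ γ k) (hu : ∀ k, u (k + 1) = T k (u k) + e k + g k) (hg : ∀ k, ‖g k‖ ≤ γ k)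
    (hDD : ∀ k, ∀ y : V, |⟪y, e k⟫_ℝ| ≤
      η * Real.sqrt (‖u k‖ ^ 2 - ‖T k (u k)‖ ^ 2) * Real.sqrt (‖y‖ ^ 2 - ‖adjoint (T k) y‖ ^ 2))
    (K : ℕ) :
    (1 - 2 * η - η ^ 2) * ∑ k ∈ Finset.range K, (‖u k‖ ^ 2 - ‖T k (u k)‖ ^ 2) + ‖u K‖ ^ 2 ≤
      ‖u 0‖ ^ 2 + 2 * (∑ k ∈ Finset.range K, γ k) * (‖u 0‖ + ∑ k ∈ Finset.range K, γ k) := by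
  induction K with
  | zero => simp
  | succ K ih =>
    rw [Finset.sum_range_succ, Finset.sum_range_succ, mul_add]
    set G : ℝ := ∑ k ∈ Finset.range K, γ k with hG_def
    have hG : 0 ≤ G := Finset.sum_nonneg fun k _ => hγ k
    have hstep := dissip_le_energy_drop (hT K) hη (hDD K)
    -- `‖u (K+1)‖ ≤ ‖T u + e‖ + γ K` and `‖T u + e‖ ≤ ‖u K‖ ≤ ‖u 0‖ + G`
    have hD : 0 ≤ ‖u K‖ ^ 2 - ‖T K (u K)‖ ^ 2 := dissip_nonneg (hT K) (u K)
    have hκ : 0 ≤ 1 - 2 * η - η ^ 2 := by nlinarith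
    have hTue : ‖T K (u K) + e K‖ ≤ ‖u K‖ := by
      have h2 : ‖T K (u K) + e K‖ ^ 2 ≤ ‖u K‖ ^ 2 := by nlinarith [mul_nonneg hκ hD]
      nlinarith [norm_nonneg (T K (u K) + e K), norm_nonneg (u K)]
    have huK : ‖u K‖ ≤ ‖u 0‖ + G := norm_perturbed_le T hT u e g γ η hη hη8 hu hg hDD K
    have hsucc : ‖u (K + 1)‖ ≤ ‖T K (u K) + e K‖ + γ K := by
      rw [hu K]; exact (norm_add_le _ _).trans (by linarith [hg K])
    have hsucc2 : ‖u (K + 1)‖ ^ 2 ≤ ‖T K (u K) + e K‖ ^ 2 + 2 * γ K * (‖u 0‖ + G) + γ K ^ 2 := by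
      have hγK := hγ K
      have h0 : 0 ≤ ‖T K (u K) + e K‖ := norm_nonneg _
      calc ‖u (K + 1)‖ ^ 2 ≤ (‖T K (u K) + e K‖ + γ K) ^ 2 :=
            pow_le_pow_left₀ (norm_nonneg _) hsucc 2
        _ = ‖T K (u K) + e K‖ ^ 2 + 2 * γ K * ‖T K (u K) + e K‖ + γ K ^ 2 := by ring
        _ ≤ ‖T K (u K) + e K‖ ^ 2 + 2 * γ K * (‖u 0‖ + G) + γ K ^ 2 := by
            nlinarith [mul_le_mul_of_nonneg_left (hTue.trans huK) hγK]
    nlinarith [hγ K, norm_nonneg (u 0)]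

/-- DISCREPANCY bound with leftovers: `‖u K − v K‖ ≤ √(2η² Σ_{k<K} 𝔇 k (u k)) + Σ_{k<K} γ k`. -/
theorem norm_sub_le_abs (T : ℕ → V →L[ℝ] V) (hT : ∀ k x, ‖T k x‖ ≤ ‖x‖) (u v e g : ℕ → V) (γ : ℕ → ℝ) (η : ℝ)
    (hη : 0 ≤ η) (hγ : ∀ k, 0 ≤ γ k) (h0 : u 0 = v 0) (hv : ∀ k, v (k + 1) = T k (v k))
    (hu : ∀ k, u (k + 1) = T k (u k) + e k + g k) (hg : ∀ k, ‖g k‖ ≤ γ k)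
    (hDD : ∀ k, ∀ y : V, |⟪y, e k⟫_ℝ| ≤
      η * Real.sqrt (‖u k‖ ^ 2 - ‖T k (u k)‖ ^ 2) * Real.sqrt (‖y‖ ^ 2 - ‖adjoint (T k) y‖ ^ 2))
    (K : ℕ) :
    ‖u K - v K‖ ≤ Real.sqrt (2 * η ^ 2 * ∑ k ∈ Finset.range K, (‖u k‖ ^ 2 - ‖T k (u k)‖ ^ 2)) +
      ∑ k ∈ Finset.range K, γ k := by
  induction K with
  | zero => simp [h0]
  | succ K ih =>
    rw [Finset.sum_range_succ, Finset.sum_range_succ, mul_add]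
    set S : ℝ := ∑ k ∈ Finset.range K, (‖u k‖ ^ 2 - ‖T k (u k)‖ ^ 2) with hS_def
    set G : ℝ := ∑ k ∈ Finset.range K, γ k with hG_def
    have hS : 0 ≤ S := Finset.sum_nonneg fun k _ => dissip_nonneg (hT k) (u k)
    have hG : 0 ≤ G := Finset.sum_nonneg fun k _ => hγ k
    have hD : 0 ≤ ‖u K‖ ^ 2 - ‖T K (u K)‖ ^ 2 := dissip_nonneg (hT K) (u K)
    have hrec : u (K + 1) - v (K + 1) = (T K (u K - v K) + e K) + g K := by
      rw [hu K, hv K, map_sub]; abel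
    rw [hrec]
    have hstep := norm_sq_apply_add_err_le (hT K) (u K - v K) hη (hDD K)
    -- `‖T d + e‖ ≤ √(‖d‖² + 2η²𝔇) ≤ √((√(2η²S) + G)² + 2η²𝔇) ≤ √(2η²S + 2η²𝔇) + G`
    have h1 : ‖T K (u K - v K) + e K‖ ≤ Real.sqrt (‖u K - v K‖ ^ 2 + 2 * η ^ 2 * (‖u K‖ ^ 2 - ‖T K (u K)‖ ^ 2)) := by
      rw [← Real.sqrt_sq (norm_nonneg (T K (u K - v K) + e K))]
      exact Real.sqrt_le_sqrt hstep
    have hA : 0 ≤ Real.sqrt (2 * η ^ 2 * S) := Real.sqrt_nonneg _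
    have h2 : Real.sqrt (‖u K - v K‖ ^ 2 + 2 * η ^ 2 * (‖u K‖ ^ 2 - ‖T K (u K)‖ ^ 2)) ≤
        Real.sqrt ((Real.sqrt (2 * η ^ 2 * S) + G) ^ 2 + 2 * η ^ 2 * (‖u K‖ ^ 2 - ‖T K (u K)‖ ^ 2)) := by
      apply Real.sqrt_le_sqrt
      have := pow_le_pow_left₀ (norm_nonneg _) ih 2
      linarith
    have h3 := sqrt_add_sq_add_le hA hG (by positivity : 0 ≤ 2 * η ^ 2 * (‖u K‖ ^ 2 - ‖T K (u K)‖ ^ 2))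
    have h4 : Real.sqrt (Real.sqrt (2 * η ^ 2 * S) ^ 2 + 2 * η ^ 2 * (‖u K‖ ^ 2 - ‖T K (u K)‖ ^ 2)) =
        Real.sqrt (2 * η ^ 2 * S + 2 * η ^ 2 * (‖u K‖ ^ 2 - ‖T K (u K)‖ ^ 2)) := by
      rw [Real.sq_sqrt (by positivity)]
    calc ‖T K (u K - v K) + e K + g K‖ ≤ ‖T K (u K - v K) + e K‖ + ‖g K‖ := norm_add_le _ _
      _ ≤ Real.sqrt (2 * η ^ 2 * S + 2 * η ^ 2 * (‖u K‖ ^ 2 - ‖T K (u K)‖ ^ 2)) + G + γ K := by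
          rw [← h4]; linarith [h1, h2, h3, hg K]
      _ = _ := by ring

/-- DUALITY SUM with leftovers: for every `z` there is `b` (the backward-propagated `z`) with `‖b‖ ≤ ‖z‖`, `⟪b, v 0⟫ = ⟪z, v K⟫` and
`|⟪z, u K − v K⟫| ≤ η √(Σ_{k<K} 𝔇 k (u k)) √(‖z‖² − ‖b‖²) + ‖z‖·Σ_{k<K} γ k`. -/
theorem duality_sum_abs (T : ℕ → V →L[ℝ] V) (hT : ∀ k x, ‖T k x‖ ≤ ‖x‖) (u v e g : ℕ → V) (γ : ℕ → ℝ) (η : ℝ)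
    (hη : 0 ≤ η) (h0 : u 0 = v 0) (hv : ∀ k, v (k + 1) = T k (v k)) (hu : ∀ k, u (k + 1) = T k (u k) + e k + g k)
    (hg : ∀ k, ‖g k‖ ≤ γ k)
    (hDD : ∀ k, ∀ y : V, |⟪y, e k⟫_ℝ| ≤
      η * Real.sqrt (‖u k‖ ^ 2 - ‖T k (u k)‖ ^ 2) * Real.sqrt (‖y‖ ^ 2 - ‖adjoint (T k) y‖ ^ 2))
    (K : ℕ) (z : V) :
    ∃ b : V, ‖b‖ ≤ ‖z‖ ∧ ⟪b, v 0⟫_ℝ = ⟪z, v K⟫_ℝ ∧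
      |⟪z, u K - v K⟫_ℝ| ≤ η * Real.sqrt (∑ k ∈ Finset.range K, (‖u k‖ ^ 2 - ‖T k (u k)‖ ^ 2)) *
        Real.sqrt (‖z‖ ^ 2 - ‖b‖ ^ 2) + ‖z‖ * ∑ k ∈ Finset.range K, γ k := by
  induction K generalizing z with
  | zero =>
    refine ⟨z, le_rfl, rfl, ?_⟩
    simp [h0]
  | succ K ih =>
    obtain ⟨b, hb, hdual, hbound⟩ := ih (adjoint (T K) z)
    have hTz : ‖adjoint (T K) z‖ ≤ ‖z‖ := norm_adjoint_apply_le_of_contraction (hT K) z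
    refine ⟨b, hb.trans hTz, ?_, ?_⟩
    · rw [hdual, adjoint_inner_left, ← hv K]
    · have hsplit : ⟪z, u (K + 1) - v (K + 1)⟫_ℝ =
          ⟪adjoint (T K) z, u K - v K⟫_ℝ + ⟪z, e K⟫_ℝ + ⟪z, g K⟫_ℝ := by
        rw [hu K, hv K, adjoint_inner_left, map_sub]
        rw [show T K (u K) + e K + g K - T K (v K) = (T K (u K) - T K (v K)) + e K + g K by abel,
          inner_add_right, inner_add_right]
      set S : ℝ := ∑ k ∈ Finset.range K, (‖u k‖ ^ 2 - ‖T k (u k)‖ ^ 2) with hS_def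
      set D : ℝ := ‖u K‖ ^ 2 - ‖T K (u K)‖ ^ 2 with hD_def
      set a : ℝ := ‖adjoint (T K) z‖ ^ 2 - ‖b‖ ^ 2 with ha_def
      set c : ℝ := ‖z‖ ^ 2 - ‖adjoint (T K) z‖ ^ 2 with hc_def
      set G : ℝ := ∑ k ∈ Finset.range K, γ k with hG_def
      have hS : 0 ≤ S := Finset.sum_nonneg fun k _ => dissip_nonneg (hT k) (u k)
      have hD : 0 ≤ D := dissip_nonneg (hT K) (u K)
      have ha : 0 ≤ a := by rw [ha_def]; nlinarith [norm_nonneg b, norm_nonneg (adjoint (T K) z)]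
      have hc : 0 ≤ c := dissipAdj_nonneg (hT K) z
      have hG0 : 0 ≤ ‖z‖ * G - ‖adjoint (T K) z‖ * G := by
        have hGn : 0 ≤ G := by
          -- `G ≥ 0` because each `γ k ≥ ‖g k‖ ≥ 0`
          exact Finset.sum_nonneg fun k _ => (norm_nonneg _).trans (hg k)
        nlinarith
      have hsum : ∑ k ∈ Finset.range (K + 1), (‖u k‖ ^ 2 - ‖T k (u k)‖ ^ 2) = S + D := by
        rw [Finset.sum_range_succ]
      have hsumγ : ∑ k ∈ Finset.range (K + 1), γ k = G + γ K := by rw [Finset.sum_range_succ]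
      have hac : ‖z‖ ^ 2 - ‖b‖ ^ 2 = a + c := by rw [ha_def, hc_def]; ring
      have hgz : |⟪z, g K⟫_ℝ| ≤ ‖z‖ * γ K :=
        (abs_real_inner_le_norm _ _).trans (mul_le_mul_of_nonneg_left (hg K) (norm_nonneg _))
      rw [hsplit, hsum, hsumγ, hac]
      calc |⟪adjoint (T K) z, u K - v K⟫_ℝ + ⟪z, e K⟫_ℝ + ⟪z, g K⟫_ℝ|
          ≤ |⟪adjoint (T K) z, u K - v K⟫_ℝ + ⟪z, e K⟫_ℝ| + |⟪z, g K⟫_ℝ| := abs_add_le _ _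
        _ ≤ |⟪adjoint (T K) z, u K - v K⟫_ℝ| + |⟪z, e K⟫_ℝ| + |⟪z, g K⟫_ℝ| := by
            linarith [abs_add_le ⟪adjoint (T K) z, u K - v K⟫_ℝ ⟪z, e K⟫_ℝ]
        _ ≤ (η * Real.sqrt S * Real.sqrt a + ‖adjoint (T K) z‖ * G) + η * Real.sqrt D * Real.sqrt c + ‖z‖ * γ K :=
            add_le_add (add_le_add hbound (hDD K z)) hgz
        _ = η * (Real.sqrt S * Real.sqrt a + Real.sqrt D * Real.sqrt c) + (‖adjoint (T K) z‖ * G + ‖z‖ * γ K) := by ring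
        _ ≤ η * (Real.sqrt (S + D) * Real.sqrt (a + c)) + (‖z‖ * G + ‖z‖ * γ K) := by
            have := mul_le_mul_of_nonneg_left (sqrt_mul_sqrt_add_le_sqrt_add_mul hS ha hD hc) hη
            linarith
        _ = η * Real.sqrt (S + D) * Real.sqrt (a + c) + ‖z‖ * (G + γ K) := by ring

/-- **THE WINDOW LEDGER WITH ABSOLUTE LEFTOVERS.**  As `window_ledger`, but each window may also carry an error `g k` that is merely small in norm,
`‖g k‖ ≤ γ k` (`γ k ≥ 0`): `u (k+1) = T k (u k) + e k + g k` with `e k` dissipation-dominated.  Then, with `G = Σ_{k<K} γ k`,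
`‖u K‖² ≤ ‖v K‖² + 3η·(‖v 0‖² − ‖v K‖²) + 6·(‖v 0‖ + G)·G`: the decay-relative term is unchanged and the leftovers enter ABSOLUTELY (in the
application they are super-small and are paid by the a-priori base drop through `m⋆(R, E)`). -/
theorem window_ledger_abs (T : ℕ → V →L[ℝ] V) (hT : ∀ k x, ‖T k x‖ ≤ ‖x‖) (u v e g : ℕ → V) (γ : ℕ → ℝ) (η : ℝ)
    (hη : 0 ≤ η) (hη8 : η ≤ 1 / 8) (hγ : ∀ k, 0 ≤ γ k)
    (h0 : u 0 = v 0) (hv : ∀ k, v (k + 1) = T k (v k)) (hu : ∀ k, u (k + 1) = T k (u k) + e k + g k)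
    (hg : ∀ k, ‖g k‖ ≤ γ k)
    (hDD : ∀ k, ∀ y : V, |⟪y, e k⟫_ℝ| ≤
      η * Real.sqrt (‖u k‖ ^ 2 - ‖T k (u k)‖ ^ 2) * Real.sqrt (‖y‖ ^ 2 - ‖adjoint (T k) y‖ ^ 2))
    (K : ℕ) :
    ‖u K‖ ^ 2 ≤ ‖v K‖ ^ 2 + 3 * η * (‖v 0‖ ^ 2 - ‖v K‖ ^ 2) +
      6 * (‖v 0‖ + ∑ k ∈ Finset.range K, γ k) * ∑ k ∈ Finset.range K, γ k := by
  set S : ℝ := ∑ k ∈ Finset.range K, (‖u k‖ ^ 2 - ‖T k (u k)‖ ^ 2) with hS_def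
  set G : ℝ := ∑ k ∈ Finset.range K, γ k with hG_def
  have hS : 0 ≤ S := Finset.sum_nonneg fun k _ => dissip_nonneg (hT k) (u k)
  have hG : 0 ≤ G := Finset.sum_nonneg fun k _ => hγ k
  have hvK : ‖v K‖ ≤ ‖v 0‖ := norm_exact_le T hT v hv K
  have hdropv : 0 ≤ ‖v 0‖ ^ 2 - ‖v K‖ ^ 2 := by nlinarith [norm_nonneg (v K)]
  have hv0 : 0 ≤ ‖v 0‖ := norm_nonneg _
  -- duality at `z = v K`
  obtain ⟨b, hb, hdual, hbound⟩ := duality_sum_abs T hT u v e g γ η hη h0 hv hu hg hDD K (v K)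
  have hvv : ⟪b, v 0⟫_ℝ = ‖v K‖ ^ 2 := by rw [hdual, real_inner_self_eq_norm_sq]
  have hkey : ‖v K‖ ^ 2 - ‖b‖ ^ 2 ≤ ‖v 0‖ ^ 2 - ‖v K‖ ^ 2 := by
    have h1 : ‖v K‖ ^ 2 ≤ ‖b‖ * ‖v 0‖ := by rw [← hvv]; exact real_inner_le_norm _ _
    by_cases h00 : ‖v 0‖ = 0
    · have : ‖v K‖ = 0 := le_antisymm (by rw [← h00]; exact hvK) (norm_nonneg _)
      rw [this, h00]; nlinarith [norm_nonneg b]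
    · have hpos : 0 < ‖v 0‖ ^ 2 := by positivity
      have h3 : (‖v K‖ ^ 2 - ‖b‖ ^ 2) * ‖v 0‖ ^ 2 ≤ (‖v 0‖ ^ 2 - ‖v K‖ ^ 2) * ‖v 0‖ ^ 2 := by
        nlinarith [norm_nonneg (v K), sq_nonneg (‖v 0‖ ^ 2 - ‖v K‖ ^ 2)]
      exact le_of_mul_le_mul_right h3 hpos
  have hcross : ⟪v K, u K - v K⟫_ℝ ≤ η * Real.sqrt S * Real.sqrt (‖v 0‖ ^ 2 - ‖v K‖ ^ 2) + ‖v K‖ * G := by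
    have hA : 0 ≤ η * Real.sqrt S := mul_nonneg hη (Real.sqrt_nonneg _)
    calc ⟪v K, u K - v K⟫_ℝ ≤ |⟪v K, u K - v K⟫_ℝ| := le_abs_self _
      _ ≤ η * Real.sqrt S * Real.sqrt (‖v K‖ ^ 2 - ‖b‖ ^ 2) + ‖v K‖ * G := hbound
      _ ≤ η * Real.sqrt S * Real.sqrt (‖v 0‖ ^ 2 - ‖v K‖ ^ 2) + ‖v K‖ * G := by
          have := mul_le_mul_of_nonneg_left (Real.sqrt_le_sqrt hkey) hA
          linarith
  have hcross' : 2 * ⟪v K, u K - v K⟫_ℝ ≤ η * (S + (‖v 0‖ ^ 2 - ‖v K‖ ^ 2)) + 2 * ‖v 0‖ * G := by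
    have := two_mul_le_add_sq (Real.sqrt S) (Real.sqrt (‖v 0‖ ^ 2 - ‖v K‖ ^ 2))
    rw [Real.sq_sqrt hS, Real.sq_sqrt hdropv] at this
    have hvKG : ‖v K‖ * G ≤ ‖v 0‖ * G := mul_le_mul_of_nonneg_right hvK hG
    nlinarith
  -- discrepancy: `‖d‖ ≤ √(2η²S) + G` ⇒ `‖d‖² ≤ 3η²S + 3G²`
  have hd := norm_sub_le_abs T hT u v e g γ η hη hγ h0 hv hu hg hDD K
  have hd2 : ‖u K - v K‖ ^ 2 ≤ 3 * η ^ 2 * S + 3 * G ^ 2 := by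
    have hq : 0 ≤ Real.sqrt (2 * η ^ 2 * S) := Real.sqrt_nonneg _
    have h1 : ‖u K - v K‖ ^ 2 ≤ (Real.sqrt (2 * η ^ 2 * S) + G) ^ 2 := pow_le_pow_left₀ (norm_nonneg _) hd 2
    have h2 : (Real.sqrt (2 * η ^ 2 * S)) ^ 2 = 2 * η ^ 2 * S := Real.sq_sqrt (by positivity)
    nlinarith [sq_nonneg (Real.sqrt (2 * η ^ 2 * S) - 2 * G)]
  -- energy sum with leftovers
  have hSu := dissip_sum_le_abs T hT u e g γ η hη hη8 hγ hu hg hDD K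
  have hexp : ‖u K‖ ^ 2 = ‖v K‖ ^ 2 + 2 * ⟪v K, u K - v K⟫_ℝ + ‖u K - v K‖ ^ 2 := by
    rw [← norm_add_sq_real, add_sub_cancel]
  have hκ : (47 : ℝ) / 64 ≤ 1 - 2 * η - η ^ 2 := by nlinarith
  rw [h0] at hSu
  by_cases hcase : ‖u K‖ ^ 2 ≤ ‖v K‖ ^ 2
  · nlinarith [mul_nonneg (mul_nonneg (by norm_num : (0:ℝ) ≤ 6) (add_nonneg hv0 hG)) hG]
  · have hdropu : ‖v 0‖ ^ 2 - ‖u K‖ ^ 2 ≤ ‖v 0‖ ^ 2 - ‖v K‖ ^ 2 := by linarith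
    have hS' : (47 : ℝ) / 64 * S ≤ (‖v 0‖ ^ 2 - ‖v K‖ ^ 2) + 2 * G * (‖v 0‖ + G) := by
      have : (47 : ℝ) / 64 * S ≤ (1 - 2 * η - η ^ 2) * S := mul_le_mul_of_nonneg_right hκ hS
      linarith
    nlinarith [mul_nonneg hv0 hG, sq_nonneg G, mul_nonneg hη hG, mul_nonneg hη (mul_nonneg hv0 hG)]

end

end Summit.AnomalousDissipation.AnomalousDissipation.Theorems.SolenoidalFractalHomogenisation.LagrangianStep
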